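import Mathlib
import HarnessLib
import Summits.HubbardSuperconductivity.HubbardSuperconductivity.Theorems.KLProgrammeKLRegimeTwoVolumeSourceFamilyPairKernel
import Summits.HubbardSuperconductivity.HubbardSuperconductivity.Theorems.KLProgrammeKLRegimeTwoVolumeSourceSmoothDefs

/-!
# Route `KLProgramme` — crux K3, VL child (stmt-HubbardSuperconductivity-20440), keying «(VL)-SRC-WINDOW» (R227)/(R236) (β), lemma (N1) INSTANTIATED:
# source-pair kernels of the windowed keyed object `srcTrunc 3 (map (toLin' (c • klSrcAnalysisAtW V M β μ K J)) 𝒱⁽ⁿ⁾)` (k3c4-p1 g17's ask, KL STATUS 17:19Z)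

Cell gate-hubbard-kl, seat p1 g22.  `…TwoVolumeSourceFamilyPairKernel` (p651399) at `A := klSrcAnalysisAtW …` (`…TwoVolumeSourceSmoothDefs`, p651691), whose
copy-`1` slot-`0` rows are the `E(F_χ)`-rows, `F_χ = srcWindowFamily V M`:
* `klSrcAnalysisAtW_apply_src` / `klSrcAnalysisAtW_apply_dead` (the two row facts);
* **`kernel_srcTrunc_map_smul_klSrcAnalysisAtW_src_two`** — on slot-`0` source pairs `X i = ((xᵢ,((0,σᵢ),cᵢ)),1)`:
  `kernel … 2 X = c² · sectorisedKernel V M β (srcWindowFamily V M) 𝒱⁽ⁿ⁾ 2 (legs) (sites)`, ANY alive index `J`;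
  **`kernel_srcTrunc_map_smul_klSrcAnalysisAtW_dead_two`** — `= 0` when a copy-`1` leg has slot `≠ 0`;
  **`kernel_srcTrunc_map_smul_klSrcAnalysisAtW_pair`** — the `(+,−)` pair at `(x,y)`, spin `↑`: `c²·W^χ(x,y)`;
* `srcWindowFamily_eq_one_of_kept` — `|2n_ω+1| ≤ M/2 ⇒ F_χ 0 (ω,k⃗) = 1` (the `hF` of `…LastScaleWindowedEndDoors`, p652035).

Proofs only; no definition; nothing asserts HB1W, (β), any VL stub, K3 or superconductivity.
References: BGM 2006 §2.7 (2.70)–(2.71), §2.9 (4.3)–(4.6) [cite: BenfattoGiulianiMastropietro2006].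
-/

noncomputable section

namespace Summit.HubbardSuperconductivity.HubbardSuperconductivity.Theorems.TwoVolumeSource

set_option linter.dupNamespace false -- summit = problem name (single-conjunct summit), D-0017

open Finset Literature.MathematicalPhysics.QuantumLattice Literature.Probability.LatticeModels GrassmannAlgebra
open Summit.HubbardSuperconductivity.HubbardSuperconductivity.Theorems.KLProgrammeLegKernels
open Summit.HubbardSuperconductivity.HubbardSuperconductivity.Theorems.KLRegimeSplit
open Summit.HubbardSuperconductivity.HubbardSuperconductivity.Theorems.TwoVolumeDefect
open Summit.HubbardSuperconductivity.HubbardSuperconductivity.Theorems.EngineV8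

variable {L M : ℕ}

/-- Copy-`1` rows in sector slot `0` of the windowed analysis are the `E(F_χ)`-rows at the relabelled one-sector leg. [cite: Salmhofer1999, App. B.5.5] -/
theorem klSrcAnalysisAtW_apply_src (β μ : ℝ) (K : TrigPolyC4v) (J : ℕ) (Y : SrcLabel L M J) (hY : Y.2 = 1) (h0 : (Y.1.2.1.1 : ℕ) = 0) :
    klSrcAnalysisAtW L M β μ K J Y = sectorAnalysisMatrix L M β (srcWindowFamily L M) (Y.1.1, (((0 : Fin 1), Y.1.2.1.2), Y.1.2.2)) := by
  ext X
  rw [klSrcAnalysisAtW_apply, if_neg (by rw [hY]; decide), if_pos h0]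

/-- Copy-`1` rows in the other sector slots of the windowed analysis are dead. [folklore] -/
theorem klSrcAnalysisAtW_apply_dead (β μ : ℝ) (K : TrigPolyC4v) (J : ℕ) (Y : SrcLabel L M J) (hY : Y.2 = 1) (h0 : (Y.1.2.1.1 : ℕ) ≠ 0) :
    klSrcAnalysisAtW L M β μ K J Y = 0 := by
  ext X
  rw [klSrcAnalysisAtW_apply, if_neg (by rw [hY]; decide), if_neg h0, Pi.zero_apply]

variable [NeZero L]

/-- **Slot-`0` source pairs of the windowed keyed object read `c²·` the `F_χ`-sectorised two-leg kernels of `𝒱⁽ⁿ⁾`, for EVERY alive index `J`.**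
[cite: BenfattoGiulianiMastropietro2006, §2.9 (4.3)-(4.6)] -/
theorem kernel_srcTrunc_map_smul_klSrcAnalysisAtW_src_two (c : ℂ) (β U μ : ℝ) (K : TrigPolyC4v) (J n : ℕ) (X : Fin 2 → SrcLabel L M J)
    (hX : ∀ i, (X i).2 = 1) (h0 : ∀ i, ((X i).1.2.1.1 : ℕ) = 0) :
    kernel ℂ (srcTrunc ℂ (fun Y : SrcLabel L M J => Y.2 = 1) 3
        (ExteriorAlgebra.map (Matrix.toLin' (c • klSrcAnalysisAtW L M β μ K J)) (klEffectiveAction L M β U μ K klE0 n))) 2 X =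
      c ^ 2 * sectorisedKernel L M β (srcWindowFamily L M) (klEffectiveAction L M β U μ K klE0 n) 2
        (fun i => ((((0 : Fin 1), (X i).1.2.1.2), (X i).1.2.2) : SectorLeg 1)) (fun i => (X i).1.1) :=
  kernel_srcTrunc_map_smul_family_src_two c _ β _ (fun Y hY h0' => klSrcAnalysisAtW_apply_src β μ K J Y hY h0') _ X hX h0

/-- **A dead source leg (slot `≠ 0`) kills the windowed source pair.** [folklore] -/
theorem kernel_srcTrunc_map_smul_klSrcAnalysisAtW_dead_two (c : ℂ) (β U μ : ℝ) (K : TrigPolyC4v) (J n : ℕ) (X : Fin 2 → SrcLabel L M J)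
    {i : Fin 2} (hX : (X i).2 = 1) (h0 : ((X i).1.2.1.1 : ℕ) ≠ 0) :
    kernel ℂ (srcTrunc ℂ (fun Y : SrcLabel L M J => Y.2 = 1) 3
        (ExteriorAlgebra.map (Matrix.toLin' (c • klSrcAnalysisAtW L M β μ K J)) (klEffectiveAction L M β U μ K klE0 n))) 2 X = 0 :=
  kernel_srcTrunc_map_smul_family_dead_two c _ (fun Y hY h0' => klSrcAnalysisAtW_apply_dead β μ K J Y hY h0') _ X hX h0

/-- **The `(+,−)` windowed source pair at `(x, y)`, spin `↑`, slot `0`, through `srcTrunc 3`: `c²·W^χ_{𝒱⁽ⁿ⁾}(x,y)`**,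
`W^χ = sectorisedKernel β (srcWindowFamily) 𝒱 2 ((0,0,+),(0,0,−))`. [cite: BenfattoGiulianiMastropietro2006, §2.9 (4.3)-(4.6)] -/
theorem kernel_srcTrunc_map_smul_klSrcAnalysisAtW_pair (c : ℂ) (β U μ : ℝ) (K : TrigPolyC4v) (J n : ℕ) (x y : SpaceTimeIdx L M) :
    kernel ℂ (srcTrunc ℂ (fun Y : SrcLabel L M J => Y.2 = 1) 3
        (ExteriorAlgebra.map (Matrix.toLin' (c • klSrcAnalysisAtW L M β μ K J)) (klEffectiveAction L M β U μ K klE0 n))) 2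
        ![((x, ((⟨0, sectorCount_pos J⟩, 0), 0)), 1), ((y, ((⟨0, sectorCount_pos J⟩, 0), 1)), 1)] =
      c ^ 2 * sectorisedKernel L M β (srcWindowFamily L M) (klEffectiveAction L M β U μ K klE0 n) 2
        (![((0, 0), 0), ((0, 0), 1)] : Fin 2 → SectorLeg 1) ![x, y] :=
  kernel_srcTrunc_map_smul_family_pair c _ β _ (fun Y hY h0' => klSrcAnalysisAtW_apply_src β μ K J Y hY h0') _ x y

omit [NeZero L] in
/-- **Kept labels carry window weight `1`**: `|2n_ω+1| ≤ M/2 ⇒ F_χ 0 (ω,k⃗) = 1` — the `hF` of the windowed END doors. [folklore] -/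
theorem srcWindowFamily_eq_one_of_kept {ω : MatsubaraIdx M} (h : |2 * (matsubaraInt M ω : ℝ) + 1| ≤ (M : ℝ) / 2) (kv : TorusSite 2 L) :
    srcWindowFamily L M 0 (ω, kv) = 1 := by
  simp only [srcWindowFamily, srcWindowWt_eq_one h, Complex.ofReal_one]

omit [NeZero L] in
/-- The family-of-families form used by `…LastScaleWindowedEndDoors`: `hF` for `F := fun V M => srcWindowFamily V M`. [folklore] -/
theorem srcWindowFamily_hF :
    ∀ (V M : ℕ) (ω : MatsubaraIdx M), |2 * (matsubaraInt M ω : ℝ) + 1| ≤ (M : ℝ) / 2 → ∀ kv : TorusSite 2 V,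
      (fun V M => srcWindowFamily V M) V M 0 (ω, kv) = 1 :=
  fun _ _ _ h kv => srcWindowFamily_eq_one_of_kept h kv

end Summit.HubbardSuperconductivity.HubbardSuperconductivity.Theorems.TwoVolumeSource

end
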